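import Summits.AtomisticToContinuum.Crystallization.Theorems.ChartedZeroExcessLayeredLatticeLiouvilleYCB

/-!
# «WarmCoolCut» part YC (lens-2 g61, 26636) — part 3 of 3 (sequel of `…ChartedZeroExcessLayeredLatticeLiouvilleYCB`)

Split for the 400-line cap by the landing lane (hand-2 g31); the module docstring of part 1 (`…ChartedZeroExcessLayeredLatticeLiouvilleYCA`) describes the whole node.  Same namespace; all FQNs unchanged.
0 sorry; standard axioms.
-/

noncomputable section
open scoped BigOperators Classical
open MeasureTheory Set Metric Filter Topology
open Summit.AtomisticToContinuum.Crystallization.Theorems.ChartedPlanarOrderRigidityDoor (E3 atomsIn VisibleGap PertRegime)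
open Summit.AtomisticToContinuum.Crystallization.Theorems.ChartedPlanarOrderDensityDichotomy (μS IsSep nK nK_nonneg)
open Summit.AtomisticToContinuum.Crystallization.Theorems.ChartedPlanarOrderCleanScaleP (IsCleanP IsDoorSetP)
open Summit.AtomisticToContinuum.Crystallization.Theorems.ChartedPlanarOrderMesoCut (LayeredHom EnvClose)
open Summit.AtomisticToContinuum.Crystallization.Theorems.ChartedPlanarOrderDoorLayered (atomsIn_subset sq_le_finsum_mem PeriodicBulkGapDoor)
open Summit.AtomisticToContinuum.Crystallization.Theorems.ChartedPlanarOrderDoorLayeredOsc (IsTwoShellAffineGood)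

namespace Summit.AtomisticToContinuum.Crystallization.Theorems.ChartedZeroExcessLayeredLatticeLiouville

/-! ### YC-5  The sparse cut: (R_Wᵇ) ⟸ [Tᵇ] ∧ [ISᵇ] ⟸ [Tᵇ] ∧ [WSᵇ] ∧ [DSᵇ] -/

/-- the **incoherent count** of `Ψ` on `Q` at the pair `(ϑ₁, ω₁)`: the number of sites `x ∈ Q` whose `4`-star is NOT `(ϑ₁, ω₁)`-coherent by `Ψ` (classical
indicator, summed with `∑ᶠ`; the GENERIC class of the site-level dichotomy).  At `ω₁ = 2` it is the WARM COUNT (sites that are not Ψ-cool). [this file, g61] -/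
def incoherentCount (ϑ₁ ω₁ : ℝ) (S : Set E3) (Ψ : E3 → E3) (Q : Set E3) : ℝ :=
  ∑ᶠ x ∈ Q, if IsCoherentBy ϑ₁ ω₁ S Ψ {x} then (0 : ℝ) else 1

/-- the **drift count**: sites of `Q` that are Ψ-cool at `ϑ₁` but NOT `(ϑ₁, ω₁)`-locked. [this file, g61] -/
def driftCount (ϑ₁ ω₁ : ℝ) (S : Set E3) (Ψ : E3 → E3) (Q : Set E3) : ℝ :=
  ∑ᶠ x ∈ Q, if IsCoherentBy ϑ₁ 2 S Ψ {x} ∧ ¬ IsCoherentBy ϑ₁ ω₁ S Ψ {x} then (1 : ℝ) else 0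

/-- the incoherent count is nonnegative. [this file, g61] -/
theorem incoherentCount_nonneg (ϑ₁ ω₁ : ℝ) (S : Set E3) (Ψ : E3 → E3) (Q : Set E3) : 0 ≤ incoherentCount ϑ₁ ω₁ S Ψ Q :=
  finsum_nonneg fun x => finsum_nonneg fun _ => by split_ifs <;> norm_num

/-- the drift count is nonnegative. [this file, g61] -/
theorem driftCount_nonneg (ϑ₁ ω₁ : ℝ) (S : Set E3) (Ψ : E3 → E3) (Q : Set E3) : 0 ≤ driftCount ϑ₁ ω₁ S Ψ Q :=
  finsum_nonneg fun x => finsum_nonneg fun _ => by split_ifs <;> norm_num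

/-- coherence on `K ⊇ Q` empties the incoherent count of `Q`. [this file, g61] -/
theorem incoherentCount_eq_zero_of_isCoherentBy {ϑ₁ ω₁ : ℝ} {S K Q : Set E3} {Ψ : E3 → E3} (h : IsCoherentBy ϑ₁ ω₁ S Ψ K) (hQ : Q ⊆ K) :
    incoherentCount ϑ₁ ω₁ S Ψ Q = 0 := by
  refine finsum_mem_of_eqOn_zero fun x hx => ?_
  have hx' : IsCoherentBy ϑ₁ ω₁ S Ψ {x} := h.mono le_rfl le_rfl (singleton_subset_iff.2 (hQ hx))
  show (if IsCoherentBy ϑ₁ ω₁ S Ψ {x} then (0 : ℝ) else 1) = 0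
  rw [if_pos hx']

/-- coherence on `K ⊇ Q` empties the drift count of `Q`. [this file, g61] -/
theorem driftCount_eq_zero_of_isCoherentBy {ϑ₁ ω₁ : ℝ} {S K Q : Set E3} {Ψ : E3 → E3} (h : IsCoherentBy ϑ₁ ω₁ S Ψ K) (hQ : Q ⊆ K) :
    driftCount ϑ₁ ω₁ S Ψ Q = 0 := by
  refine finsum_mem_of_eqOn_zero fun x hx => ?_
  have hx' : IsCoherentBy ϑ₁ ω₁ S Ψ {x} := h.mono le_rfl le_rfl (singleton_subset_iff.2 (hQ hx))
  show (if IsCoherentBy ϑ₁ 2 S Ψ {x} ∧ ¬ IsCoherentBy ϑ₁ ω₁ S Ψ {x} then (1 : ℝ) else 0) = 0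
  rw [if_neg (fun h' => h'.2 hx')]

/-- **UNION BOUND (PROVED)**: an incoherent site is warm or drifting — `incoherentCount ϑ₁ ω₁ ≤ incoherentCount ϑ₁ 2 + driftCount ϑ₁ ω₁` on a finite `Q`. [this file, g61] -/
theorem incoherentCount_le_warm_add_drift {ϑ₁ ω₁ : ℝ} {S Q : Set E3} {Ψ : E3 → E3} (hQ : Q.Finite) :
    incoherentCount ϑ₁ ω₁ S Ψ Q ≤ incoherentCount ϑ₁ 2 S Ψ Q + driftCount ϑ₁ ω₁ S Ψ Q := by
  rw [incoherentCount, incoherentCount, driftCount, finsum_mem_eq_finite_toFinset_sum _ hQ, finsum_mem_eq_finite_toFinset_sum _ hQ,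
    finsum_mem_eq_finite_toFinset_sum _ hQ, ← Finset.sum_add_distrib]
  refine Finset.sum_le_sum fun x _ => ?_
  by_cases h1 : IsCoherentBy ϑ₁ ω₁ S Ψ {x}
  · rw [if_pos h1]
    have ha : (0 : ℝ) ≤ (if IsCoherentBy ϑ₁ 2 S Ψ {x} then (0 : ℝ) else 1) := by split_ifs <;> norm_num
    have hb : (0 : ℝ) ≤ (if IsCoherentBy ϑ₁ 2 S Ψ {x} ∧ ¬ IsCoherentBy ϑ₁ ω₁ S Ψ {x} then (1 : ℝ) else 0) := by split_ifs <;> norm_num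
    exact add_nonneg ha hb
  · rw [if_neg h1]
    by_cases h2 : IsCoherentBy ϑ₁ 2 S Ψ {x}
    · rw [if_pos h2, if_pos ⟨h2, h1⟩]; norm_num
    · rw [if_neg h2, if_neg (fun h' => h2 h'.1)]; norm_num

/-- ★ **wild mass against the incoherent count (PROVED)** — for a tear-free (`4 ↦ 8`) map `Ψ` on a `δ`-separated `S` and a pair with `4·ω₁ + ϑ₁ < ϑ`: a
`ϑ`-wild bond at `x` makes `x` incoherent (part YB `dist_bond_le_of_isCoherentBy`), each site carries `≤ (8/δ+1)³` bonds of squared distortion `≤ 144`; hence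
`wildMass ϑ (win R) Ψ ≤ 144·(8/δ+1)³ · incoherentCount ϑ₁ ω₁ S Ψ (win R)`.  The indicator form of part TR `wildMass_le_of_tiltStrainData`. [this file, g61] -/
theorem wildMass_le_incoherentCount {δ ϑ ϑ₁ ω₁ : ℝ} (hδ : 0 < δ) {S : Set E3} (hsep : IsSep δ S) {R : ℝ} {Ψ : E3 → E3}
    (htear : ∀ x ∈ S, ∀ p ∈ S, dist p x ≤ 4 → dist (Ψ p) (Ψ x) ≤ 8) (hside : 4 * ω₁ + ϑ₁ < ϑ) :
    wildMass ϑ (atomsIn (μS S) 0 R) Ψ ≤ 144 * (2 * 4 / δ + 1) ^ 3 * incoherentCount ϑ₁ ω₁ S Ψ (atomsIn (μS S) 0 R) := by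
  set W := atomsIn (μS S) 0 R with hWdef
  have hWfin : W.Finite := finite_atomsIn hδ hsep R
  have hWS : W ⊆ S := fun y hy => (mem_atomsIn_iff.1 hy).1
  have hN₄ : (0 : ℝ) ≤ 144 * (2 * 4 / δ + 1) ^ 3 := by positivity
  have hinner : ∀ x ∈ W,
      ∑ᶠ p ∈ W ∩ closedBall x 4, (if ϑ ≤ dist (p - x) (Ψ p - Ψ x) then dist (p - x) (Ψ p - Ψ x) ^ 2 else 0) ≤
        144 * (2 * 4 / δ + 1) ^ 3 * (if IsCoherentBy ϑ₁ ω₁ S Ψ {x} then (0 : ℝ) else 1) := by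
    intro x hx
    have hxS : x ∈ S := hWS hx
    have hfin : (W ∩ closedBall x 4).Finite := hWfin.inter_of_left _
    by_cases hcoh : IsCoherentBy ϑ₁ ω₁ S Ψ {x}
    · -- a coherent site carries no wild bond
      have h0 : ∑ᶠ p ∈ W ∩ closedBall x 4,
          (if ϑ ≤ dist (p - x) (Ψ p - Ψ x) then dist (p - x) (Ψ p - Ψ x) ^ 2 else 0) = 0 := by
        refine finsum_mem_of_eqOn_zero fun p hp => ?_
        have h1 : dist (p - x) (Ψ p - Ψ x) < ϑ :=
          (dist_bond_le_of_isCoherentBy hcoh (mem_singleton x) (hWS hp.1) (mem_closedBall.1 hp.2)).trans_lt hside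
        show (if ϑ ≤ dist (p - x) (Ψ p - Ψ x) then dist (p - x) (Ψ p - Ψ x) ^ 2 else 0) = 0
        rw [if_neg (not_le.2 h1)]
      rw [h0, if_pos hcoh, mul_zero]
    · -- an incoherent site: each of its `≤ (8/δ+1)³` bonds has squared distortion `≤ 144`
      have hterm : ∀ p ∈ W ∩ closedBall x 4,
          (if ϑ ≤ dist (p - x) (Ψ p - Ψ x) then dist (p - x) (Ψ p - Ψ x) ^ 2 else 0) ≤ (144 : ℝ) := by
        intro p hp
        have hpS : p ∈ S := hWS hp.1
        have hpx : dist p x ≤ 4 := mem_closedBall.1 hp.2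
        have hd12 : dist (p - x) (Ψ p - Ψ x) ≤ 12 := by
          rw [dist_eq_norm]
          calc ‖p - x - (Ψ p - Ψ x)‖ ≤ ‖p - x‖ + ‖Ψ p - Ψ x‖ := norm_sub_le _ _
            _ ≤ 4 + 8 := add_le_add (by rwa [← dist_eq_norm]) (by rw [← dist_eq_norm]; exact htear x hxS p hpS hpx)
            _ = 12 := by norm_num
        have hd0 : 0 ≤ dist (p - x) (Ψ p - Ψ x) := dist_nonneg
        split_ifs
        · nlinarith
        · norm_num
      have hsum : ∑ᶠ p ∈ W ∩ closedBall x 4,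
          (if ϑ ≤ dist (p - x) (Ψ p - Ψ x) then dist (p - x) (Ψ p - Ψ x) ^ 2 else 0) ≤ ∑ᶠ _p ∈ W ∩ closedBall x 4, (144 : ℝ) := by
        rw [finsum_mem_eq_finite_toFinset_sum _ hfin, finsum_mem_eq_finite_toFinset_sum _ hfin]
        exact Finset.sum_le_sum fun p hp => hterm p (hfin.mem_toFinset.1 hp)
      have hcount : ∑ᶠ _p ∈ W ∩ closedBall x 4, (144 : ℝ) = 144 * ((W ∩ closedBall x 4).ncard : ℝ) := by
        rw [finsum_mem_eq_finite_toFinset_sum _ hfin, Finset.sum_const, nsmul_eq_mul, Set.ncard_eq_toFinset_card _ hfin, mul_comm]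
      have hN : ((W ∩ closedBall x 4).ncard : ℝ) ≤ (2 * 4 / δ + 1) ^ 3 := ncard_window_inter_closedBall_four_le hδ hsep hWS hWfin x
      calc ∑ᶠ p ∈ W ∩ closedBall x 4, (if ϑ ≤ dist (p - x) (Ψ p - Ψ x) then dist (p - x) (Ψ p - Ψ x) ^ 2 else 0)
          ≤ 144 * ((W ∩ closedBall x 4).ncard : ℝ) := hsum.trans_eq hcount
        _ ≤ 144 * (2 * 4 / δ + 1) ^ 3 := mul_le_mul_of_nonneg_left hN (by norm_num)
        _ = 144 * (2 * 4 / δ + 1) ^ 3 * (if IsCoherentBy ϑ₁ ω₁ S Ψ {x} then (0 : ℝ) else 1) := by rw [if_neg hcoh, mul_one]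
  have hfi := finsum_mem_eq_finite_toFinset_sum (fun x => if IsCoherentBy ϑ₁ ω₁ S Ψ {x} then (0 : ℝ) else 1) hWfin
  rw [wildMass, incoherentCount, finsum_mem_eq_finite_toFinset_sum _ hWfin, hfi, Finset.mul_sum]
  exact Finset.sum_le_sum fun x hx => hinner x (hWfin.mem_toFinset.1 hx)

/-- ★★ **[ISᵇ] «IncoherenceSparseBPG ϑ₁ ω₁ ϑ aHi Λ θ s» — ON TAME FAT NEAR-FLAT GSC DOOR WINDOWS THE INCOHERENT SITES ARE `o(η)`-SPARSE.**  With (R_Wᵇ)'s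
binder prefix (`∀ δ a Cg`, then `∀ εw K₀ ∃ η₁ R₁`) and [W_Ψᵇ₁]'s hypotheses (bond-isomorphic registered `Ψ`, fat window, `ϑ`-tame on `win 9R`): the sites of
`win R` whose star is NOT `(ϑ₁, ω₁)`-coherent by `Ψ` number `≤ εw·η·nK(win R)`.  THE SITE-LEVEL SPECIAL/GENERIC DICHOTOMY OF THE LENS: the special class
(coherent sites) carries no wild bond, the generic class (incoherent sites) is not excluded but SPARSE — which is all (R_Wᵇ) asks (`wildFractionBPG_of_tame_sparse`,
PROVED).  The kinematic half is free (YC-1/YC-6: `#incoherent ≤ Στ²/ϑ₁² ≲ Cg·η·nK/ϑ₁²`, i.e. the statement at `εw ≍ Cg/ϑ₁²`); the content is the `o(1)`: NO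
CONCENTRATION OF THE REGISTRATION BUDGET ON HIGH-AMPLITUDE SITES — the COUNT SHADOW of the tree's `L³` pair (K) ∧ (Mᵇ) for the given bond isomorphism
(`incoherentCount_le_of_tiltStrainData`, PROVED).  Cut further as [WSᵇ] ∧ [DSᵇ] (`incoherenceSparseBPG_of_warm_drift`, PROVED).  NEW ·
GSC-priced · UNDECIDED · INSTRUMENTABLE ((F1) «CoherenceScan»: the incoherent-count column at the pair, per window, against `η·nK`) · WEAKER than [W_Ψᵇ₁|c] for
every `c ≥ 1` (`incoherenceSparseBPG_of_coherentAt`, PROVED: the count is zero).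
Why it might fail: the hot-spot/warm-lens scenario at density `≍ η` (as (R_Wᵇ)): a density `≍ η` of bounded self-equilibrated anomalies each costing `O(1)`
incoherent sites saturates Chebyshev; nothing below density `o(η)` threatens it.
Sources: parts TB/UI ((R_W)/(R_Wᵇ)); part TR ((K)/(M), the `L³` form of the same accounting); part TZ (`strainMassAbove`, (M♭)); part YB; CRITIC-LEDGER row 1160. [this file, g61] -/
def IncoherenceSparseBPG (ϑ₁ ω₁ ϑ aHi Λ θ s : ℝ) : Prop :=
  ∀ δ : ℝ, 0 < δ → ∀ a : ℝ, 0 < a → ∀ Cg : ℝ, 1 ≤ Cg →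
    ∀ εw : ℝ, 0 < εw → ∀ K₀ : ℝ, 0 < K₀ → ∃ η₁ : ℝ, 0 < η₁ ∧ ∃ R₁ : ℝ, 0 < R₁ ∧
      ∀ S : Set E3, IsDoorSetPG aHi δ S → (∀ q ∈ S, IsTwoShellAffineGood θ S q) →
        ∀ η : ℝ, 0 < η → η ≤ η₁ → ∀ R : ℝ, R₁ ≤ R →
          ∀ (L : E3 ≃L[ℝ] E3) (w : ℤ → E3), IsEquilChart a s Λ L w →
            ∀ Ψ : E3 → E3, IsGlobalReg Cg η R S (LayeredHom (L : E3 →L[ℝ] E3) w) Ψ → IsBondIso S Ψ →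
              K₀ ≤ η * nK (atomsIn (μS S) 0 R) →
                IsTameOn ϑ S (LayeredHom (L : E3 →L[ℝ] E3) w) (atomsIn (μS S) 0 (9 * R)) →
                incoherentCount ϑ₁ ω₁ S Ψ (atomsIn (μS S) 0 R) ≤ εw * η * nK (atomsIn (μS S) 0 R)

/-- ★★ **[WSᵇ] «WarmSparseBPG ϑ₁ ϑ aHi Λ θ s» — WARM SITES ARE `o(η)`-SPARSE** ([ISᵇ] at `ω₁ = 2`: the sites of `win R` that are NOT Ψ-cool at `ϑ₁` number
`≤ εw·η·nK(win R)`).  The SPARSE form of the misfit gain [ΨCoolᵇ]: no pointwise claim in the warm band.  It is the COUNT SHADOW of (Mᵇ) `StrainNonConcentrationBPG`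
(part UI) for the GIVEN bond isomorphism: tilt–strain data `(Q, σ)` of `Ψ` with `Σ_{win R} σ³ ≤ ε·η·nK` give `#warm ≤ Σσ³/ϑ₁³ ≤ (ε/ϑ₁³)·η·nK`
(`incoherentCount_le_of_tiltStrainData` at `ω₁ = 2`, PROVED; a site with `σ x ≤ ϑ₁` is Ψ-cool with `U := Q x`).  Mechanism = (M)'s (KNOWN-type route, UNDECIDED
here): HIGHER INTEGRABILITY of the registration strain of μ-equilibria — Caccioppoli MODULO RIGID MOTIONS on balls (the GSC inequality tested with COMPACTLY
SUPPORTED competitors: rigidly re-fitted patches of the same-word chart, feathered by a cut-off), then Gehring's lemma (`(⨍σ^p)^{1/p} ≤ C·(⨍τ²)^{1/2}`, some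
`p > 2`; tree fact `ZatorskaGoldstein2005_localGehringLemmaCounting`), Chebyshev at `ϑ₁`.  NOT the naive energy balance «`E_S(win) − E_H(Ψ win) ≥ c·Σm² − C·R²`
⊕ quadratic excess ⇒ `#warm = O(R²)`»: between two equilibria the first variation of a window energy is boundary WORK `Σ_{∂win} F^{ext}·(u − rigid) ≲
ρ^{3/2}·(Σ_{win} m²)^{1/2}` (rigidity + trace), larger than the quadratic gain at every small strain — recorded dead end (with part UC's word floor).  NEW as a
typed leaf · GSC-priced · UNDECIDED(stated test: (F0c) «WarmScan» count column per window against `η·nK`) · INSTRUMENTABLE · ATTACKABLE·L along (M)'s route for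
the bond-isomorphic `Ψ` (no re-registration freedom is needed: a bond isomorphism is rigid) · WEAKER than [ΨCoolᵇ] (`warmSparseBPG_of_psiCool`, PROVED).
Why it might fail: as (M)/(R_Wᵇ) — warm lenses / hot spots at spatial density `≍ η`, each of registration cost `O(1)`, saturating Chebyshev; and the
reverse-Hölder step needs the re-fitted competitors to stay in the door class (basin `η ≤ η₁`).
Sources: part TR ((M) `StrainNonConcentrationPG`: Meyers 1963; Gehring, Acta Math. 130 (1973) 265; Giaquinta–Modica 1979; [giaquinta1984 Ch. V]); part UI
((Mᵇ)); `Literature` fact `ZatorskaGoldstein2005_localGehringLemmaCounting`; part UC (word floor); CRITIC-LEDGER row 1160 (iii) (γ). [this file, g61] -/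
def WarmSparseBPG (ϑ₁ ϑ aHi Λ θ s : ℝ) : Prop :=
  IncoherenceSparseBPG ϑ₁ 2 ϑ aHi Λ θ s

/-- ★★ **[DSᵇ] «DriftSparseBPG ϑ₁ ω₁ ϑ aHi Λ θ s» — COOL-BUT-DRIFTING SITES ARE `o(η)`-SPARSE**: with [ISᵇ]'s binders, the sites of `win R` that are Ψ-cool at
`ϑ₁` but not `(ϑ₁, ω₁)`-locked number `≤ εw·η·nK(win R)`.  The SPARSE form of the orientation locking [CoolLockedᵇ], WITHOUT its everywhere-cool hypothesis
(warm sites may be present but are someone else's count): ε-regularity OFF A SPARSE SET — at a cool site `x` all of whose dyadic balls `B(x, 2ᵏ) ⊆ win 8R`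
have warm fraction `≤ κ` the excess-decay iteration of [CoolLockedᵇ] runs with the warm stars as an `O(κ)`-perturbation (a-priori distortion `≤ 12`), and
the sites failing the dyadic condition are `≤ C·#warm/κ` by the maximal-function (Vitali) bound — so [DSᵇ] ⟸ [WSᵇ] ⊕ «locking off a κ-sparse set» is the
foreseen second layer; and it is the COUNT SHADOW of (K) `TiltRigidityP` (part TR) given (M)-for-`Ψ`: `#incoherent ≤ Σσ³/ϑ₁³ + Σtilt³/ω₁³`
(`incoherentCount_le_of_tiltStrainData`, PROVED) with (K)'s `Σtilt³ ≤ C_K·Σσ³ + ε·η·nK`.  Mechanism KNOWN-type (FJM rigidity in `L³`, or excess decay as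
[CoolLockedᵇ]) · GSC-priced · UNDECIDED · TRUE-type-expected · ATTACKABLE·L · INSTRUMENTABLE ((F1) drift column) · WEAKER than [W_Ψᵇ₁|c], `c ≥ 1`
(`driftSparseBPG_of_coherentAt`, PROVED).
Why it might fail: as [CoolLockedᵇ] (equilibrium needed at every scale; John's spiral shows kinematics gives only BMO), plus warm clusters concentrated in
one mesoscopic ball (locally not sparse) — harmless for the COUNT (those balls hold `≤ C·#warm/κ` sites) but fatal for a sup-norm claim.
Sources: as [CoolLockedᵇ]; Evans 1986 / [giaquinta1984 Ch. IV] (partial regularity off a small set); part YB. [this file, g61] -/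
def DriftSparseBPG (ϑ₁ ω₁ ϑ aHi Λ θ s : ℝ) : Prop :=
  ∀ δ : ℝ, 0 < δ → ∀ a : ℝ, 0 < a → ∀ Cg : ℝ, 1 ≤ Cg →
    ∀ εw : ℝ, 0 < εw → ∀ K₀ : ℝ, 0 < K₀ → ∃ η₁ : ℝ, 0 < η₁ ∧ ∃ R₁ : ℝ, 0 < R₁ ∧
      ∀ S : Set E3, IsDoorSetPG aHi δ S → (∀ q ∈ S, IsTwoShellAffineGood θ S q) →
        ∀ η : ℝ, 0 < η → η ≤ η₁ → ∀ R : ℝ, R₁ ≤ R →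
          ∀ (L : E3 ≃L[ℝ] E3) (w : ℤ → E3), IsEquilChart a s Λ L w →
            ∀ Ψ : E3 → E3, IsGlobalReg Cg η R S (LayeredHom (L : E3 →L[ℝ] E3) w) Ψ → IsBondIso S Ψ →
              K₀ ≤ η * nK (atomsIn (μS S) 0 R) →
                IsTameOn ϑ S (LayeredHom (L : E3 →L[ℝ] E3) w) (atomsIn (μS S) 0 (9 * R)) →
                driftCount ϑ₁ ω₁ S Ψ (atomsIn (μS S) 0 R) ≤ εw * η * nK (atomsIn (μS S) 0 R)

/-- ★★ **GLUE (PROVED): [WSᵇ](ϑ₁) ∧ [DSᵇ](ϑ₁, ω₁) ⇒ [ISᵇ](ϑ₁, ω₁)** (`εw/2` each, union bound). [this file, g61] -/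
theorem incoherenceSparseBPG_of_warm_drift {ϑ₁ ω₁ ϑ aHi Λ θ s : ℝ} (hW : WarmSparseBPG ϑ₁ ϑ aHi Λ θ s) (hD : DriftSparseBPG ϑ₁ ω₁ ϑ aHi Λ θ s) :
    IncoherenceSparseBPG ϑ₁ ω₁ ϑ aHi Λ θ s := by
  intro δ hδ a ha Cg hCg εw hεw K₀ hK₀
  obtain ⟨η₂, hη₂, R₂, hR₂, h2⟩ := hW δ hδ a ha Cg hCg (εw / 2) (by positivity) K₀ hK₀
  obtain ⟨η₃, hη₃, R₃, hR₃, h3⟩ := hD δ hδ a ha Cg hCg (εw / 2) (by positivity) K₀ hK₀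
  refine ⟨min η₂ η₃, lt_min hη₂ hη₃, max R₂ R₃, lt_max_of_lt_left hR₂, ?_⟩
  intro S hS hgood η hη hηle R hR L w hLw Ψ hΨ hBI hfat htame
  have ha' := h2 S hS hgood η hη (hηle.trans (min_le_left _ _)) R ((le_max_left _ _).trans hR) L w hLw Ψ hΨ hBI hfat htame
  have hb' := h3 S hS hgood η hη (hηle.trans (min_le_right _ _)) R ((le_max_right _ _).trans hR) L w hLw Ψ hΨ hBI hfat htame
  have hfin : (atomsIn (μS S) 0 R).Finite := finite_atomsIn hδ hS.1.2.1 R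
  calc incoherentCount ϑ₁ ω₁ S Ψ (atomsIn (μS S) 0 R)
      ≤ incoherentCount ϑ₁ 2 S Ψ (atomsIn (μS S) 0 R) + driftCount ϑ₁ ω₁ S Ψ (atomsIn (μS S) 0 R) := incoherentCount_le_warm_add_drift hfin
    _ ≤ εw / 2 * η * nK (atomsIn (μS S) 0 R) + εw / 2 * η * nK (atomsIn (μS S) 0 R) := add_le_add ha' hb'
    _ = εw * η * nK (atomsIn (μS S) 0 R) := by ring

/-- ★★ **SEAM (PROVED): (R_Wᵇ) ⟸ [Tᵇ] ∧ [ISᵇ] under the side condition `4·ω₁ + ϑ₁ < tameRadius`** (`Ψ' := Ψ`, `Cg' := Cg`, [ISᵇ] at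
`εw / (144·(8/δ+1)³)`; `wildMass_le_incoherentCount`). [this file, g61] -/
theorem wildFractionBPG_of_tame_sparse {ϑ₁ ω₁ ϑ aHi Λ θ s : ℝ} (hside : 4 * ω₁ + ϑ₁ < tameRadius)
    (hT : TameWindowBPG ϑ aHi Λ θ s) (hIS : IncoherenceSparseBPG ϑ₁ ω₁ ϑ aHi Λ θ s) : WildFractionBPG aHi Λ θ s := by
  intro δ hδ a ha Cg hCg
  refine ⟨Cg, le_rfl, fun εw hεw K₀ hK₀ => ?_⟩
  have hN : (0 : ℝ) < 144 * (2 * 4 / δ + 1) ^ 3 := by positivity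
  obtain ⟨η₂, hη₂, R₂, hR₂, h2⟩ := hT δ hδ a ha Cg hCg K₀ hK₀
  obtain ⟨η₃, hη₃, R₃, hR₃, h3⟩ := hIS δ hδ a ha Cg hCg (εw / (144 * (2 * 4 / δ + 1) ^ 3)) (div_pos hεw hN) K₀ hK₀
  refine ⟨min η₂ η₃, lt_min hη₂ hη₃, max R₂ R₃, lt_max_of_lt_left hR₂, ?_⟩
  intro S hS hgood η hη hηle R hR L w hLw Ψ hΨ hBI hfat
  have htame := h2 S hS hgood η hη (hηle.trans (min_le_left _ _)) R ((le_max_left _ _).trans hR) L w hLw Ψ hΨ hBI hfat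
  have hcnt := h3 S hS hgood η hη (hηle.trans (min_le_right _ _)) R ((le_max_right _ _).trans hR) L w hLw Ψ hΨ hBI hfat htame
  refine ⟨Ψ, hΨ, ?_⟩
  calc wildMass tameRadius (atomsIn (μS S) 0 R) Ψ
      ≤ 144 * (2 * 4 / δ + 1) ^ 3 * incoherentCount ϑ₁ ω₁ S Ψ (atomsIn (μS S) 0 R) :=
        wildMass_le_incoherentCount hδ hS.1.2.1 hΨ.2.1 hside
    _ ≤ 144 * (2 * 4 / δ + 1) ^ 3 * (εw / (144 * (2 * 4 / δ + 1) ^ 3) * η * nK (atomsIn (μS S) 0 R)) :=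
        mul_le_mul_of_nonneg_left hcnt hN.le
    _ = εw * η * nK (atomsIn (μS S) 0 R) := by field_simp

/-- **[W_Ψᵇ₁|c] ⇒ [ISᵇ] for every `c ≥ 1` (PROVED)** — coherence on `win (c·R) ⊇ win R` makes the count ZERO. [this file, g61] -/
theorem incoherenceSparseBPG_of_coherentAt {c ϑ₁ ω₁ ϑ aHi Λ θ s : ℝ} (hc : 1 ≤ c) (h : CoherentWindowPsiBPGAt c ϑ₁ ω₁ ϑ aHi Λ θ s) :
    IncoherenceSparseBPG ϑ₁ ω₁ ϑ aHi Λ θ s := by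
  intro δ hδ a ha Cg hCg εw hεw K₀ hK₀
  obtain ⟨η₁, hη₁, R₁, hR₁, h1⟩ := h δ hδ a ha Cg hCg K₀ hK₀
  refine ⟨η₁, hη₁, R₁, hR₁, fun S hS hgood η hη hηle R hR L w hLw Ψ hΨ hBI hfat htame => ?_⟩
  have hcoh := h1 S hS hgood η hη hηle R hR L w hLw Ψ hΨ hBI hfat htame
  have hsub : atomsIn (μS S) 0 R ⊆ atomsIn (μS S) 0 (c * R) := by
    have h' := atomsIn_mono_mul (S := S) hc (hR₁.le.trans hR)
    rwa [one_mul] at h'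
  rw [incoherentCount_eq_zero_of_isCoherentBy hcoh hsub]
  exact mul_nonneg (mul_nonneg hεw.le hη.le) (nK_nonneg _)

/-- **[ΨCoolᵇ](ϑ₁) ⇒ [WSᵇ](ϑ₁) (PROVED)** — Ψ-coolness on `win 8R ⊇ win R` empties the warm count. [this file, g61] -/
theorem warmSparseBPG_of_psiCool {ϑ₁ ϑ aHi Λ θ s : ℝ} (h : PsiCoolWindowBPG ϑ₁ ϑ aHi Λ θ s) : WarmSparseBPG ϑ₁ ϑ aHi Λ θ s := by
  intro δ hδ a ha Cg hCg εw hεw K₀ hK₀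
  obtain ⟨η₁, hη₁, R₁, hR₁, h1⟩ := h δ hδ a ha Cg hCg K₀ hK₀
  refine ⟨η₁, hη₁, R₁, hR₁, fun S hS hgood η hη hηle R hR L w hLw Ψ hΨ hBI hfat htame => ?_⟩
  have hcoh := h1 S hS hgood η hη hηle R hR L w hLw Ψ hΨ hBI hfat htame
  have hsub : atomsIn (μS S) 0 R ⊆ atomsIn (μS S) 0 (8 * R) := by
    have h' := atomsIn_mono_mul (S := S) (by norm_num : (1 : ℝ) ≤ 8) (hR₁.le.trans hR)
    rwa [one_mul] at h'
  rw [incoherentCount_eq_zero_of_isCoherentBy hcoh hsub]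
  exact mul_nonneg (mul_nonneg hεw.le hη.le) (nK_nonneg _)

/-- **[W_Ψᵇ₁|c] ⇒ [DSᵇ] for every `c ≥ 1` (PROVED)** — coherence empties the drift count. [this file, g61] -/
theorem driftSparseBPG_of_coherentAt {c ϑ₁ ω₁ ϑ aHi Λ θ s : ℝ} (hc : 1 ≤ c) (h : CoherentWindowPsiBPGAt c ϑ₁ ω₁ ϑ aHi Λ θ s) :
    DriftSparseBPG ϑ₁ ω₁ ϑ aHi Λ θ s := by
  intro δ hδ a ha Cg hCg εw hεw K₀ hK₀
  obtain ⟨η₁, hη₁, R₁, hR₁, h1⟩ := h δ hδ a ha Cg hCg K₀ hK₀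
  refine ⟨η₁, hη₁, R₁, hR₁, fun S hS hgood η hη hηle R hR L w hLw Ψ hΨ hBI hfat htame => ?_⟩
  have hcoh := h1 S hS hgood η hη hηle R hR L w hLw Ψ hΨ hBI hfat htame
  have hsub : atomsIn (μS S) 0 R ⊆ atomsIn (μS S) 0 (c * R) := by
    have h' := atomsIn_mono_mul (S := S) hc (hR₁.le.trans hR)
    rwa [one_mul] at h'
  rw [driftCount_eq_zero_of_isCoherentBy hcoh hsub]
  exact mul_nonneg (mul_nonneg hεw.le hη.le) (nK_nonneg _)

/-- (R_Wᵇ) from [I_D] ∧ [T_bᵇ] ∧ [WSᵇ] ∧ [DSᵇ] under the side condition (PROVED). [this file, g61] -/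
theorem wildFractionBPG_of_dressedCore_sparse {ϑ₁ ω₁ ϑ ϑe ωe : ℝ} {p : ℕ} {r₀ ℓ : ℝ} {M : ℕ} {aHi Λ θ s : ℝ} (hside : 4 * ω₁ + ϑ₁ < tameRadius)
    (hI : DressedCorePG ϑ ϑe ωe p r₀ ℓ M aHi Λ θ s) (hTb : BareTameWindowBPG ϑ ϑe ωe p r₀ ℓ M aHi Λ θ s)
    (hW : WarmSparseBPG ϑ₁ ϑ aHi Λ θ s) (hD : DriftSparseBPG ϑ₁ ω₁ ϑ aHi Λ θ s) : WildFractionBPG aHi Λ θ s :=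
  wildFractionBPG_of_tame_sparse hside (tameWindowBPG_of_dressedCore_of_bare hI hTb) (incoherenceSparseBPG_of_warm_drift hW hD)

/-- ★★★ **COLUMN `_16XH22Bˢ`** — `_16XH21B₁` with the residual [W_Ψᵇ₁](1/100, 1/200) replaced by its SPARSE shadow, cut by site class: [WSᵇ](1/100) (warm
sites `o(η)`-sparse: the (M)-currency, higher integrability of the bond-isomorphic registration strain) ∧ [DSᵇ](1/100, 1/200) (cool-but-drifting sites
`o(η)`-sparse: the (K)-currency / ε-regularity off a sparse set) — the COUNT SHADOW of column `_16XH19B_tol`'s (K) ∧ (Mᵇ) for the given `Ψ`.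
Every hypothesis here is implied by the corresponding one of `_16XH22B` (PROVED certificates), so this is the FINEST docket of the file. [this file, g61] -/
theorem gap_and_pert_1_50_of_certs_16XH22Bs (hL : LatticeLiouvilleCert) (hL' : LayeredLiouvilleCert)
    (hR : OscRigidityL2BDPG 1 2 (1 / 16) (1 / 16)) (hX : ExcessFlatnessControlP 1 2 (1 / 16) (1 / 16))
    (hE : ExcessChartLocalisationP 1 2 (1 / 16) (1 / 100)) (hP : RegistrationP 1 2 (1 / 16) (1 / 100))
    (hT : TailDominationCert) (hU : UniformTameStabilityE (1 / 50) 2 (1 / 2000))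
    (h1 : WordTransplantP 1 2 (1 / 16) (1 / 100)) (hGT : GradReframingThickP 1 2 (1 / 16) (1 / 100) (1 / 50))
    (hΛ0 : LaunderingAprioriPX 1 2 (1 / 16) (1 / 100) (1 / 50)) (hΛs : LaunderingStepPX 1 2 (1 / 16) (1 / 100) (1 / 50))
    (hUc : UntwistCollarP 1 2 (1 / 16) (1 / 50))
    (hl : BondIsoLevelsP 1 2 (1 / 16) (1 / 50)) (hN : EnergyNearChartPX 1 2 (1 / 16) (1 / 50) (1 / 2000))
    (hF : TailForceSlavingP 1 2 (1 / 16) (1 / 50))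
    (hE' : LipDualLinearisationP 1 2 (1 / 16) (1 / 50)) (hA : L2HarmonicApproxPE 1 2 (1 / 16) (1 / 50) (1 / 2000))
    (hD : PositionDecayPLE 1 2 (1 / 16) (1 / 50) (1 / 2000)) (hC : PositionCaccioppoliPGE 1 2 (1 / 16) (1 / 50) (1 / 2000))
    (hI : DressedCorePG tameRadius dressLevel dressLevel dressExponent 8 collarRadius clusterSize 1 2 (1 / 16) (1 / 50))
    (hTb : BareTameWindowBPG tameRadius dressLevel dressLevel dressExponent 8 collarRadius clusterSize 1 2 (1 / 16) (1 / 50))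
    (hWS : WarmSparseBPG (1 / 100) tameRadius 1 2 (1 / 16) (1 / 50))
    (hDS : DriftSparseBPG (1 / 100) (1 / 200) tameRadius 1 2 (1 / 16) (1 / 50))
    (hG : PeriodicBulkGapDoor 2) : VisibleGap (1 / 50) ∧ PertRegime (1 / 50) :=
  gap_and_pert_1_50_of_certs_16XH18B_tol hL hL' hR hX hE hP hT hU h1 hGT hΛ0 hΛs hUc (untwistBookkeepingP_one 2 (1 / 50)) hl hN hF hE' hA hD hC
    (wildFractionBPG_of_dressedCore_sparse (by norm_num [tameRadius]) hI hTb hWS hDS) hG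

/-- the sparse docket is implied by the sup docket at the column literals (PROVED). [this file, g61] -/
theorem warmSparse_and_driftSparse_of_psiCool_coolLocked {ϑ aHi Λ θ s : ℝ} (hC : PsiCoolWindowBPG (1 / 100) ϑ aHi Λ θ s)
    (hL : CoolLockedWindowBPG (1 / 100) (1 / 200) ϑ aHi Λ θ s) :
    WarmSparseBPG (1 / 100) ϑ aHi Λ θ s ∧ DriftSparseBPG (1 / 100) (1 / 200) ϑ aHi Λ θ s :=
  ⟨warmSparseBPG_of_psiCool hC, driftSparseBPG_of_coherentAt (by norm_num) (coherentWindowPsiBPGAt_seven_of_cool_locked hC hL)⟩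

/-! ### YC-6  The kinematic half, quantified: Chebyshev on the registration profile -/

/-- ★ **KINEMATIC INCOHERENCE BOUND (PROVED)**: if on the finite chunk `W` every `4`-bond at `x` is distorted by at most `τ x` under `Ψ` (domination; no sign condition needed),
then for `ϑ₁ > 0` the `(ϑ₁, 0)`-incoherent sites of `W` — a fortiori the `(ϑ₁, ω₁)`-incoherent ones — number at most `Σ_W τ² / ϑ₁²`: the profile has to
exceed `ϑ₁` at each of them (`isCoherentBy_zero_of_dom`).  With part Q's registration at `D = R + 4` (level `Cg·(1 + 4/R)·η`) this is
`incoherentCount ≤ Cg·(1+4/R)·η·nK(win (R+4))/ϑ₁²`: [ISᵇ] at `εw ≍ Cg/ϑ₁²` is free; its content is `εw → 0`. [this file, g61] -/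
theorem incoherentCount_le_of_dom_sq {ϑ₁ ω₁ : ℝ} (hϑ₁ : 0 < ϑ₁) (hω₁ : 0 ≤ ω₁) {S W : Set E3} (hW : W.Finite) {Ψ : E3 → E3} {τ : E3 → ℝ}
    (hdom : ∀ x ∈ W, ∀ p ∈ S, dist p x ≤ 4 → dist (p - x) (Ψ p - Ψ x) ≤ τ x) :
    incoherentCount ϑ₁ ω₁ S Ψ W ≤ (∑ᶠ x ∈ W, τ x ^ 2) / ϑ₁ ^ 2 := by
  have hϑ2 : 0 < ϑ₁ ^ 2 := by positivity
  rw [le_div_iff₀ hϑ2, incoherentCount, finsum_mem_eq_finite_toFinset_sum _ hW, finsum_mem_eq_finite_toFinset_sum _ hW, Finset.sum_mul]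
  refine Finset.sum_le_sum fun x hx => ?_
  have hxW : x ∈ W := hW.mem_toFinset.1 hx
  by_cases hle : τ x ≤ ϑ₁
  · have hcoh : IsCoherentBy ϑ₁ ω₁ S Ψ {x} :=
      (isCoherentBy_zero_of_dom (K := {x}) fun y hy p hp hpy => by
        rw [mem_singleton_iff.1 hy] at hpy ⊢; exact (hdom x hxW p hp hpy).trans hle).mono le_rfl hω₁ Subset.rfl
    rw [if_pos hcoh, zero_mul]; positivity
  · have h1 : ϑ₁ ^ 2 ≤ τ x ^ 2 := by
      have := not_le.1 hle
      nlinarith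
    split_ifs
    · rw [zero_mul]; positivity
    · rw [one_mul]; exact h1

/-- ★ **THE COUNT SHADOW OF (K) ∧ (M) (PROVED)**: for ANY tilt–strain data `(Q, σ)` of `Ψ` on `win R` (part TR) and `ϑ₁, ω₁ > 0`, the
`(ϑ₁, ω₁)`-incoherent sites of `win R` number at most `Σ_{win R} σ³/ϑ₁³ + Σ_{win R} tilt(Q x)³/ω₁³` — a site with `σ x ≤ ϑ₁` and `tilt (Q x) ≤ ω₁` is coherent
with `U := Q x`.  With (M)-for-`Ψ` (`Σσ³ ≤ ε·η·nK`) and (K) (`Σtilt³ ≤ C_K·Σσ³ + ε·η·nK`) this is [ISᵇ] at `εw = ε/ϑ₁³ + (C_K + 1)·ε/ω₁³`; at `ω₁ = 2` it is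
[WSᵇ] from (M) alone. [this file, g61] -/
theorem incoherentCount_le_of_tiltStrainData {ϑ₁ ω₁ : ℝ} (hϑ₁ : 0 < ϑ₁) (hω₁ : 0 < ω₁) {S : Set E3} {R : ℝ} (hW : (atomsIn (μS S) 0 R).Finite)
    {Ψ : E3 → E3} {Q : E3 → (E3 ≃ₗᵢ[ℝ] E3)} {σ : E3 → ℝ} (h : IsTiltStrainData S R Ψ Q σ) :
    incoherentCount ϑ₁ ω₁ S Ψ (atomsIn (μS S) 0 R) ≤
      (∑ᶠ x ∈ atomsIn (μS S) 0 R, σ x ^ 3) / ϑ₁ ^ 3 + (∑ᶠ x ∈ atomsIn (μS S) 0 R, tilt (Q x) ^ 3) / ω₁ ^ 3 := by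
  have hϑ3 : 0 < ϑ₁ ^ 3 := by positivity
  have hω3 : 0 < ω₁ ^ 3 := by positivity
  rw [incoherentCount, finsum_mem_eq_finite_toFinset_sum _ hW, finsum_mem_eq_finite_toFinset_sum _ hW, finsum_mem_eq_finite_toFinset_sum _ hW,
    Finset.sum_div, Finset.sum_div, ← Finset.sum_add_distrib]
  refine Finset.sum_le_sum fun x hx => ?_
  have hxW : x ∈ atomsIn (μS S) 0 R := hW.mem_toFinset.1 hx
  have hσ0 : 0 ≤ σ x := h.2.1 x
  have ha : 0 ≤ σ x ^ 3 / ϑ₁ ^ 3 := by positivity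
  have hb : 0 ≤ tilt (Q x) ^ 3 / ω₁ ^ 3 := div_nonneg (pow_nonneg (tilt_nonneg _) 3) hω3.le
  by_cases hσ : σ x ≤ ϑ₁
  · by_cases ht : tilt (Q x) ≤ ω₁
    · have hcoh : IsCoherentBy ϑ₁ ω₁ S Ψ {x} := fun y hy => by
        rw [mem_singleton_iff.1 hy]
        exact ⟨Q x, h.1 x, ht, fun p hp hpx => (h.2.2 x hxW p hp hpx).trans hσ⟩
      rw [if_pos hcoh]; exact add_nonneg ha hb
    · have h1 : 1 ≤ tilt (Q x) ^ 3 / ω₁ ^ 3 := by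
        rw [le_div_iff₀ hω3, one_mul]
        exact pow_le_pow_left₀ hω₁.le (not_le.1 ht).le 3
      split_ifs
      · exact add_nonneg ha hb
      · linarith
  · have h1 : 1 ≤ σ x ^ 3 / ϑ₁ ^ 3 := by
      rw [le_div_iff₀ hϑ3, one_mul]
      exact pow_le_pow_left₀ hϑ₁.le (not_le.1 hσ).le 3
    split_ifs
    · exact add_nonneg ha hb
    · linarith

end Summit.AtomisticToContinuum.Crystallization.Theorems.ChartedZeroExcessLayeredLatticeLiouville

end
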